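import Mathlib
import HarnessLib
import Literature.MathematicalPhysics.StatisticalMechanics.WeightTraceBoundABKM
import Literature.MathematicalPhysics.StatisticalMechanics.WeightTowerIntegrationMultipliers

/-!
# Theorem 7.1 (w7) for the [ABKM19] weight data on the torus:
# `∫ w_k^X(φ + ψ) μ_{k+1}(dψ) ≤ (A_𝒫/2)^{|X|_k} w_{k:k+1}^X(φ)`

Composition of the integration property against the true step covariance
(`WeightTowerIntegrationMultipliers.integral_weight_add_le_of_multipliers`: margin automatic, trace
of `√𝒞 A_k^X √𝒞` in the exponent) with the trace bound of Lemma 7.7 (i) for `abkmWeightData`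
(`WeightTraceBoundABKM.trace_form_abkm_le`: `≤ traceConst · |X|_k`): for odd `L ≥ 2^{d+3}+16R`,
a `k`-polymer `X` and every field `φ`,
`∫ w_k^X(φ + ψ) N(0, 𝒞_{k+1})(dψ) ≤ weightIntConst^{|X|_k} · w_{k:k+1}^X(φ)` with
`weightIntConst = (1 − θ)^{−traceConst/(2θ)}`, `θ = (1+θ̄)⁻¹` — [ABKM19] Theorem 7.1 (w7) at
`q = 0`, `ρ̃ = 0`, with `A_𝒫/2 = weightIntConst` INDEPENDENT of `L` and `N` (so it also serves as
the block constant `A_𝓑/2` of (w8)).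

* `circulant_eq_mulMat_cExt`, `tailMul_neg_of_cExt` (bookkeeping);
* `weightIntConst`, `one_le_weightIntConst`;
* **`integral_weight_abkm_le`**.

Everything is proved; no named fact.

## References
* S. Adams, S. Buchholz, R. Kotecký, S. Müller, arXiv:1910.13564, Theorem 7.1 (w7), (w8),
  Lemma 7.7 [AdamsBuchholzKoteckyMuller2019].
-/

noncomputable section

namespace Literature.MathematicalPhysics.StatisticalMechanics.GradientRG

open Finset Matrix Real MeasureTheory ProbabilityTheory WithLp
open scoped MatrixOrder
open Literature.MathematicalPhysics.StatisticalMechanics.GradientFRD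
  (iterDiff mulMat fourierCoeff cExt cExt_of_mem circulant_eq_mulMat)
open Literature.MathematicalPhysics.StatisticalMechanics.TorusPolymer (IsPolymer numBlocks)

variable {d M : ℕ} [NeZero M]

/-- The step covariance as a multiplier matrix of the extended coefficients:
`circulant 𝒞_{k+1} = mulMat (cExt N 𝒞̂ (k+1))` for even `𝒞_{k+1}`, `k+1 ≤ N+1`.
[cite: AdamsBuchholzKoteckyMuller2019, Ch. 7.1 (7.5)] -/
theorem circulant_eq_mulMat_cExt {N k : ℕ} (hk : k + 1 ≤ N + 1) {𝒞 : ℕ → (Fin d → ZMod M) → ℝ}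
    (heven : ∀ x, 𝒞 (k + 1) (-x) = 𝒞 (k + 1) x) :
    Matrix.circulant (𝒞 (k + 1)) = mulMat fun κ => cExt N (fun j => fourierCoeff (𝒞 j) κ) (k + 1) := by
  rw [circulant_eq_mulMat heven]; congr 1; funext κ; rw [cExt_of_mem (by omega) hk]

omit [NeZero M] in
/-- The tails `t_k = Σ_{j>k} c_j` are even when the coefficients are.
[cite: AdamsBuchholzKoteckyMuller2019, Lemma 7.3 (7.31)] -/
theorem tailMul_neg_of_cExt [NeZero M] {N : ℕ} {f : (Fin d → ZMod M) → ℕ → ℂ}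
    (hf_even : ∀ (κ : Fin d → ZMod M) (j : ℕ), cExt N (f (-κ)) j = cExt N (f κ) j) (k : ℕ)
    (κ : Fin d → ZMod M) : tailMul N f k (-κ) = tailMul N f k κ := by
  unfold tailMul; exact Finset.sum_congr rfl fun j _ => hf_even κ j

/-- **The constant `A_𝒫/2 = (1−θ)^{−c₁/(2θ)}`**, `θ = (1+θ̄)⁻¹`, of Theorem 7.1 (w7) for the torus
weights (from the trace bound `c₁ = traceConst` and the determinant estimate
`log det(1 − K)^{-1/2} ≤ −(log(1−θ)/(2θ)) tr K` for `0 ≤ K ≤ θ < 1`).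
[cite: AdamsBuchholzKoteckyMuller2019, Theorem 7.1 (w7)] -/
def weightIntConst (θbar c₁ : ℝ) : ℝ :=
  (1 - (1 + θbar)⁻¹) ^ (-(c₁ / (2 * (1 + θbar)⁻¹)))

/-- `A_𝒫/2 ≥ 1` for `θ̄ > 0`, `c₁ ≥ 0`. [cite: AdamsBuchholzKoteckyMuller2019, Theorem 7.1 (w7)] -/
theorem one_le_weightIntConst {θbar c₁ : ℝ} (hθbar : 0 < θbar) (hc₁ : 0 ≤ c₁) :
    1 ≤ weightIntConst θbar c₁ := by
  unfold weightIntConst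
  have h1 : 0 < 1 - (1 + θbar)⁻¹ := by
    rw [sub_pos]; exact inv_lt_one_of_one_lt₀ (by linarith)
  have h2 : 1 - (1 + θbar)⁻¹ ≤ 1 := by
    have : 0 < (1 + θbar)⁻¹ := inv_pos.2 (by linarith)
    linarith
  exact Real.one_le_rpow_of_pos_of_le_one_of_nonpos h1 h2
    (neg_nonpos.2 (div_nonneg hc₁ (by positivity)))

/-- `traceConst ≥ 0`. [cite: AdamsBuchholzKoteckyMuller2019, Lemma 7.7 (i) (7.78)] -/
theorem traceConst_nonneg (d Mord R : ℕ) {lam CS : ℝ} (hlam : 0 ≤ lam) (hCS : 0 ≤ CS) :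
    0 ≤ traceConst d Mord R lam CS := by
  unfold traceConst
  exact mul_nonneg (mul_nonneg (mul_nonneg (inv_nonneg.2 hlam) (by positivity)) hCS)
    (Finset.sum_nonneg fun _ _ => by positivity)

/-- **[ABKM19] Theorem 7.1 (w7) for the weight data on the torus** (at `q = 0`, `ρ̃ = 0`): for odd
`L ≥ 2^{d+3} + 16R`, `1 ≤ M_ord ≤ R`, `d ≥ 2`, the data `abkmWeightData L N Mord R θ̄ δ' 𝒞`
dominated by the multiplier sequence with `0 < θ̄ ≤ θ_k`, `λ > 0`, even coefficients with
non-negative multipliers vanishing at the zero mode, the step kernel `𝒞_{k+1}` (`k + 1 ≤ N + 1`)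
even with the real-space bounds (iv) up to order `n ≥ 2M_ord`, and a `k`-polymer `X`:
`∫ w_k^X(φ + ψ) N(0, circulant 𝒞_{k+1})(dψ) ≤ weightIntConst^{|X|_k} · w_{k:k+1}^X(φ)`.
[cite: AdamsBuchholzKoteckyMuller2019, Theorem 7.1 (w7)] -/
theorem integral_weight_abkm_le {L N Mord R : ℕ} (hd : 2 ≤ d) (hMord : 1 ≤ Mord) (hMR : Mord ≤ R)
    (hLodd : Odd L) (hL : 2 ^ (d + 3) + 16 * R ≤ L) {θbar : ℝ} (hθbar : 0 < θbar) {δ' : ℕ → ℝ}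
    {𝒞 : ℕ → (Fin d → ZMod M) → ℝ} {lam : ℝ} (hlam : 0 < lam) {θ : ℕ → ℝ}
    (hθlo : ∀ k, θbar ≤ θ k)
    (hnn : ∀ (j : ℕ) (κ : Fin d → ZMod M), 0 ≤ cExt N (fun j => fourierCoeff (𝒞 j) κ) j)
    (hf_zero : ∀ j : ℕ, cExt N (fun j => fourierCoeff (𝒞 j) (0 : Fin d → ZMod M)) j = 0)
    (hf_even : ∀ (κ : Fin d → ZMod M) (j : ℕ), cExt N (fun j => fourierCoeff (𝒞 j) (-κ)) j =
      cExt N (fun j => fourierCoeff (𝒞 j) κ) j)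
    (hD : (abkmWeightData L N Mord R θbar δ' 𝒞).Dominated fun k =>
      mulMat (domMul lam θ (fun k => derivMul (L : ℝ) k (diffIndex d Mord))
        (tailMul N fun κ j => fourierCoeff (𝒞 j) κ) k))
    {k : ℕ} (hk : k + 1 ≤ N + 1) (heven : ∀ x, 𝒞 (k + 1) (-x) = 𝒞 (k + 1) x)
    {n : ℕ} (hn : 2 * Mord ≤ n) {Cα : (Fin d → ℕ) → ℕ → ℝ}
    (hreg : ∀ θ' : Fin d → ℕ, ∑ i, θ' i ≤ n → ∀ x,
      |iterDiff θ' (𝒞 (k + 1)) x| ≤ Cα θ' 0 / (L : ℝ) ^ ((k + 1 - 1) * (d - 2 + ∑ i, θ' i)))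
    {X : Finset (Fin d → ZMod M)} (hX : IsPolymer (L ^ k) X) (φ : (Fin d → ZMod M) → ℝ) :
    ∫ ψ, (abkmWeightData L N Mord R θbar δ' 𝒞).weight k X (φ + ofLp ψ)
        ∂(multivariateGaussian 0 (Matrix.circulant (𝒞 (k + 1)))) ≤
      weightIntConst θbar (traceConst d Mord R lam (derivSum d n Cα)) ^ numBlocks (L ^ k) X *
        (abkmWeightData L N Mord R θbar δ' 𝒞).midWeight k X φ := by
  set W := abkmWeightData L N Mord R θbar δ' 𝒞 with hW
  have hθw : ∀ k, 0 ≤ 1 + θ k := fun k => by linarith [hθlo k]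
  -- (w7) against the true covariance, trace in the exponent
  have hcov : W.cov k = mulMat fun κ => (1 + θbar) * cExt N (fun j => fourierCoeff (𝒞 j) κ) (k + 1) :=
    rfl
  have hF := WeightData.integral_weight_add_le_of_multipliers W (c := fun j κ =>
      cExt N (fun j => fourierCoeff (𝒞 j) κ) j) hD hcov hθbar (hθlo k) hlam.le
    (fun k κ => derivMul_neg _ k _ κ) (fun κ => derivMul_nonneg (Nat.cast_nonneg L) k _ κ)
    (fun κ => hf_even κ (k + 1)) (fun κ => hnn (k + 1) κ)
    (fun k κ => tailMul_neg_of_cExt hf_even k κ) (fun κ => tailMul_succ N _ k κ)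
    (fun κ => tailMul_nonneg (fun κ j => hnn j κ) (k + 1) κ) X φ
  rw [← circulant_eq_mulMat_cExt hk heven] at hF
  refine hF.trans (mul_le_mul_of_nonneg_right ?_ (WeightData.midWeight_pos _ _ _).le)
  -- the trace bound and monotonicity of `a ↦ (1−θ)^{−a/(2θ)}`
  have htr := trace_form_abkm_le hd hMord hMR hLodd hL hlam hθw hnn hf_zero hD hk heven hn hreg hX
  set θw : ℝ := (1 + θbar)⁻¹ with hθwdef
  have hθw0 : 0 < θw := inv_pos.2 (by linarith)
  have hθw1 : θw < 1 := inv_lt_one_of_one_lt₀ (by linarith)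
  have h1θ : 0 < 1 - θw := by linarith
  set c₁ := traceConst d Mord R lam (derivSum d n Cα) with hc₁
  calc (1 - θw) ^ (-((CFC.sqrt (Matrix.circulant (𝒞 (k + 1))) * W.form k X *
          CFC.sqrt (Matrix.circulant (𝒞 (k + 1)))).trace / (2 * θw)))
      ≤ (1 - θw) ^ (-(c₁ * numBlocks (L ^ k) X / (2 * θw))) := by
        refine Real.rpow_le_rpow_of_exponent_ge h1θ (by linarith) (neg_le_neg ?_)
        exact div_le_div_of_nonneg_right htr (by linarith)
    _ = weightIntConst θbar c₁ ^ numBlocks (L ^ k) X := by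
        rw [weightIntConst, ← hθwdef, ← Real.rpow_natCast, ← Real.rpow_mul h1θ.le]
        congr 1; ring

end Literature.MathematicalPhysics.StatisticalMechanics.GradientRG

end
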